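import Literature.Analysis.ODE.RiccatiInequalityAC
import Mathlib.Analysis.MeanInequalities
import Mathlib.MeasureTheory.Integral.IntervalIntegral.LebesgueDifferentiationThm
import HarnessLib

/-!
# Lei–Zhang 2011, Lemma 3.2: the time argument (real-variable lemmas)

Analysis/FluidPDE proofs file (theorems only), on the discharge path of the named fact
`Literature.Analysis.FluidPDE.LeiZhang2011_liouville` (Z. Lei, Q. S. Zhang, J. Funct. Anal. 261
(2011) = arXiv:1011.5066, Theorem 1.2). The second half of the proof of Lemma 3.2 (arXiv p. 10)
is an argument about one real function of time, `Ψ̄(s)`, once the slice estimates give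

* `∂ₛΨ̄ ≤ C` (the differential inequality with the good terms dropped),
* `∂ₛΨ̄ ≤ 0` whenever `Ψ̄(s)` is above a threshold (the axis term `−CΨ̄` absorbs `C`), and
* `∂ₛΨ̄ ≤ −a₀Ψ̄²` on the set `W` of times of large mass, above the threshold (Nash's inequality);

together with `|W| ≥ γT` (the measure of `W`, from the mass lower bound (3.1)). The lemmas of
this file isolate that argument, for a function given in time-integrated form
`Y(s₂) − Y(s₁) = ∫_{s₁}^{s₂} R`:

* `le_threshold_or_riccati` (the two cases of p. 10: "if for some `s₀` … `Ψ̄(s₀) ≤ …` then we are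
  done … Otherwise … solving the Riccati inequality gives `Ψ̄(−c₀/4) ≤ …`"):
  `Y(t) ≤ max Θ (2/(a₀γT)) + KT` on `[−γT/2, 0]`;
* `measureReal_superlevel_ge` — the measure of `W = {s : g(s) ≥ θ}` from `∫ g ≥ m`, `g ≤ G_m`
  ("if `|W| < 3c₀/4` then `‖Φ̃‖_{L¹} < … < c₀`, a contradiction", p. 10);
* `setIntegral_ge_of_setIntegral_rpow_quarter` — `∫_B F ≥ (16/27)(∫_B F^{1/4})⁴/|B|³`
  (weighted AM–GM), converting the tree's `L^{1/4}` mass bound of Lemma 3.4 into the `L¹` mass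
  used on `W`.

## References

* Z. Lei, Q. S. Zhang, J. Funct. Anal. 261 (2011) = arXiv:1011.5066, proof of Lemma 3.2, p. 10.
  [LeiZhang2011]
-/

noncomputable section

open MeasureTheory Set Filter intervalIntegral
open scoped Topology NNReal ENNReal

namespace Literature.Analysis.FluidPDE

namespace LeiZhang2011

open Literature.Analysis.ODE

/-- **The two cases of the time argument of Lemma 3.2** (Lei–Zhang 2011, p. 10). Let `T > 0`,
`Y(s₂) − Y(s₁) = ∫_{s₁}^{s₂} R` for `−T ≤ s₁ ≤ s₂ ≤ 0` with `R` integrable on `[−T, 0]`, let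
`W ⊆ (−T/4, 0]` be measurable with `|W| ≥ γT` (`γ > 0`), and suppose that for a.e.
`s ∈ (−T, 0]`: `R(s) ≤ K`; `R(s) ≤ 0` if `Y(s) ≥ Θ`; and `R(s) ≤ −a₀Y(s)²` if moreover `s ∈ W`
(`K ≥ 0`, `Θ, a₀ > 0`). Then `Y(t) ≤ max Θ (2/(a₀γT)) + KT` for all `t ∈ [−γT/2, 0]`: either
`Y(s₀) ≤ Θ` for some `s₀ ∈ [−T/4, −γT/2]` and then `Y(t) ≤ Θ + K(t − s₀)`, or `Y > Θ` on that
interval, where the Riccati inequality `Y' ≤ −a₀ 1_W Y²` integrates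
(`le_inv_integral_of_deriv_le`) to `Y(−γT/2) ≤ (a₀|W ∩ (−T/4, −γT/2]|)⁻¹ ≤ 2/(a₀γT)`. [cite: LeiZhang2011, proof of Lemma 3.2 (arXiv p. 10), from (3.5) to the end] -/
theorem le_threshold_or_riccati {Y R : ℝ → ℝ} {T K Θ a₀ γ : ℝ} (hT : 0 < T) (hK : 0 ≤ K)
    (hΘ : 0 < Θ) (ha₀ : 0 < a₀) (hγ : 0 < γ)
    (hRi : IntervalIntegrable R volume (-T) 0)
    (hY : ∀ s₁ s₂, -T ≤ s₁ → s₁ ≤ s₂ → s₂ ≤ 0 → Y s₂ - Y s₁ = ∫ s in s₁..s₂, R s)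
    {W : Set ℝ} (hWm : MeasurableSet W) (hWsub : W ⊆ Ioc (-(T / 4)) 0)
    (hWvol : γ * T ≤ volume.real W)
    (hR1 : ∀ᵐ s ∂(volume.restrict (Ioc (-T) 0)), R s ≤ K)
    (hR2 : ∀ᵐ s ∂(volume.restrict (Ioc (-T) 0)), s ∈ W → Θ ≤ Y s → R s ≤ -(a₀ * Y s ^ 2))
    (hR3 : ∀ᵐ s ∂(volume.restrict (Ioc (-T) 0)), Θ ≤ Y s → R s ≤ 0) :
    ∀ t ∈ Icc (-(γ * T / 2)) 0, Y t ≤ max Θ (2 / (a₀ * γ * T)) + K * T := by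
  -- `γ ≤ 1/4` since `W ⊆ (−T/4, 0]`
  have hγ4 : γ * T ≤ T / 4 := by
    have h := measureReal_mono (μ := (volume : Measure ℝ)) hWsub (by
      rw [Real.volume_Ioc]; exact ENNReal.ofReal_ne_top)
    rw [Real.volume_real_Ioc_of_le (by linarith)] at h
    linarith
  -- the increment bound `Y t ≤ Y s + K (t − s)` for `−T < s ≤ t ≤ 0`... from `R ≤ K` a.e.
  have hincr : ∀ s t, -T ≤ s → s ≤ t → t ≤ 0 → Y t ≤ Y s + K * (t - s) := by
    intro s t hs hst ht
    have h := hY s t hs hst ht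
    have hsub : Ioc s t ⊆ Ioc (-T) 0 := Ioc_subset_Ioc hs ht
    have hRi' : IntegrableOn R (Ioc s t) volume := hRi.1.mono_set hsub
    have hle : ∫ x in s..t, R x ≤ ∫ x in s..t, K := by
      rw [intervalIntegral.integral_of_le hst, intervalIntegral.integral_of_le hst]
      refine setIntegral_mono_ae_restrict hRi' (integrableOn_const (by
        rw [Real.volume_Ioc]; exact ENNReal.ofReal_ne_top)) ?_
      exact ae_restrict_of_ae_restrict_of_subset hsub hR1
    rw [intervalIntegral.integral_const, smul_eq_mul] at hle
    linarith
  intro t ht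
  by_cases hA : ∃ s₀ ∈ Icc (-(T / 4)) (-(γ * T / 2)), Y s₀ ≤ Θ
  · -- Case A: below the threshold somewhere in `[−T/4, −γT/2]`
    obtain ⟨s₀, hs₀, hYs₀⟩ := hA
    have h := hincr s₀ t (by linarith [hs₀.1]) (by linarith [hs₀.2, ht.1]) ht.2
    have hKT : K * (t - s₀) ≤ K * T := mul_le_mul_of_nonneg_left (by linarith [hs₀.1, ht.2]) hK
    calc Y t ≤ Θ + K * T := by linarith
      _ ≤ max Θ (2 / (a₀ * γ * T)) + K * T := by gcongr; exact le_max_left _ _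
  · -- Case B: above the threshold on `[t₀, t₁] = [−T/4, −γT/2]`: Riccati
    push Not at hA
    set t₀ : ℝ := -(T / 4) with ht₀
    set t₁ : ℝ := -(γ * T / 2) with ht₁
    have ht₀₁ : t₀ ≤ t₁ := by rw [ht₀, ht₁]; linarith
    have hTt₀ : -T ≤ t₀ := by rw [ht₀]; linarith
    have ht₁0 : t₁ ≤ 0 := by rw [ht₁]; linarith [mul_pos hγ hT]
    have hIcc : uIcc (-T) 0 = Icc (-T) 0 := uIcc_of_le (by linarith)
    -- the absolutely continuous representative `y = Y(−T) + ∫_{−T}^· R`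
    set y : ℝ → ℝ := fun s => Y (-T) + ∫ τ in (-T)..s, R τ with hy
    have hyY : ∀ s ∈ Icc (-T) 0, y s = Y s := by
      intro s hs
      have := hY (-T) s le_rfl hs.1 hs.2
      simp only [hy]; linarith
    have hyac : AbsolutelyContinuousOnInterval y t₀ t₁ := by
      have h1 : AbsolutelyContinuousOnInterval (fun s => ∫ τ in (-T)..s, R τ) (-T) 0 :=
        hRi.absolutelyContinuousOnInterval_intervalIntegral (by rw [hIcc]; exact ⟨le_rfl, by linarith⟩)
      have h2 : AbsolutelyContinuousOnInterval (fun _ : ℝ => Y (-T)) (-T) 0 :=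
        contDiffOn_const.absolutelyContinuousOnInterval
      have h3 := h2.add h1
      refine h3.mono ?_
      rw [hIcc, uIcc_of_le ht₀₁]
      exact Icc_subset_Icc hTt₀ ht₁0
    have hypos : ∀ s ∈ Icc t₀ t₁, 0 < y s := by
      intro s hs
      rw [hyY s ⟨hTt₀.trans hs.1, hs.2.trans ht₁0⟩]
      exact hΘ.trans (hA s hs)
    -- the coefficient `a = a₀ 1_W`
    set a : ℝ → ℝ := W.indicator fun _ => a₀ with ha
    have hai : IntervalIntegrable a volume t₀ t₁ := by
      refine (intervalIntegrable_const (c := a₀)).mono_fun' ?_ ?_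
      · exact ((measurable_const (a := a₀)).indicator hWm).aestronglyMeasurable
      · refine ae_of_all _ fun s => (norm_indicator_le_norm_self _ _).trans ?_
        rw [Real.norm_eq_abs, abs_of_pos ha₀]
    -- `y' = R` a.e., and the differential inequality
    have hderiv : ∀ᵐ s, s ∈ Icc t₀ t₁ → deriv y s ≤ -(a s * y s ^ 2) := by
      have hLeb := hRi.ae_hasDerivAt_integral
      have hR2' := (ae_restrict_iff' measurableSet_Ioc).1 hR2
      have hR3' := (ae_restrict_iff' measurableSet_Ioc).1 hR3
      filter_upwards [hLeb, hR2', hR3'] with s hL h2 h3 hs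
      have hsI : s ∈ Icc (-T) 0 := ⟨hTt₀.trans hs.1, hs.2.trans ht₁0⟩
      have hsIoc : s ∈ Ioc (-T) 0 := ⟨by rw [ht₀] at hs; linarith [hs.1], hsI.2⟩
      have hd : HasDerivAt y (R s) s := by
        have h := hL (by rw [hIcc]; exact hsI) (-T) (by rw [hIcc]; exact ⟨le_rfl, by linarith⟩)
        exact h.const_add _
      rw [hd.deriv, hyY s hsI]
      have hΘY : Θ ≤ Y s := (hA s hs).le
      by_cases hsW : s ∈ W
      · rw [ha, indicator_of_mem hsW]
        exact h2 hsIoc hsW hΘY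
      · rw [ha, indicator_of_notMem hsW, zero_mul, neg_zero]
        exact h3 hsIoc hΘY
    -- `∫ a = a₀ |W ∩ (t₀, t₁]| ≥ a₀ γ T / 2 > 0`
    have hWfin : volume W ≠ ∞ :=
      measure_ne_top_of_subset hWsub (by rw [Real.volume_Ioc]; exact ENNReal.ofReal_ne_top)
    have hvolW : γ * T / 2 ≤ volume.real (W ∩ Ioc t₀ t₁) := by
      have hsplit := measureReal_inter_add_sdiff (μ := (volume : Measure ℝ)) (s := W) measurableSet_Ioc
        (t := Ioc t₀ t₁) hWfin
      have hdiff : volume.real (W \ Ioc t₀ t₁) ≤ γ * T / 2 := by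
        have hsub : W \ Ioc t₀ t₁ ⊆ Ioc t₁ 0 := by
          intro s hs
          have hsW := hWsub hs.1
          have hns : s ∉ Ioc t₀ t₁ := hs.2
          rw [mem_Ioc, not_and, not_le] at hns
          exact ⟨hns hsW.1, hsW.2⟩
        calc volume.real (W \ Ioc t₀ t₁) ≤ volume.real (Ioc t₁ 0) :=
              measureReal_mono hsub (by rw [Real.volume_Ioc]; exact ENNReal.ofReal_ne_top)
          _ = γ * T / 2 := by rw [Real.volume_real_Ioc_of_le ht₁0, ht₁]; ring
      linarith
    have hinta : ∫ s in t₀..t₁, a s = a₀ * volume.real (W ∩ Ioc t₀ t₁) := by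
      rw [intervalIntegral.integral_of_le ht₀₁, ha, MeasureTheory.integral_indicator hWm, Measure.restrict_restrict hWm,
        setIntegral_const, smul_eq_mul, mul_comm]
    have hApos : 0 < ∫ s in t₀..t₁, a s := by
      rw [hinta]; exact mul_pos ha₀ (lt_of_lt_of_le (by positivity) hvolW)
    have hRic := le_inv_integral_of_deriv_le ht₀₁ hyac hypos hai hderiv hApos
    -- `Y t₁ ≤ 2/(a₀ γ T)`
    have hYt₁ : Y t₁ ≤ 2 / (a₀ * γ * T) := by
      rw [← hyY t₁ ⟨hTt₀.trans ht₀₁, ht₁0⟩]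
      refine hRic.trans ?_
      rw [hinta]
      calc (a₀ * volume.real (W ∩ Ioc t₀ t₁))⁻¹ ≤ (a₀ * (γ * T / 2))⁻¹ :=
            inv_anti₀ (by positivity) (mul_le_mul_of_nonneg_left hvolW ha₀.le)
        _ = 2 / (a₀ * γ * T) := by field_simp
    have h := hincr t₁ t (hTt₀.trans ht₀₁) ht.1 ht.2
    have hKT : K * (t - t₁) ≤ K * T := mul_le_mul_of_nonneg_left (by rw [ht₁]; linarith [ht.2, mul_pos hγ hT]) hK
    calc Y t ≤ 2 / (a₀ * γ * T) + K * T := by linarith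
      _ ≤ max Θ (2 / (a₀ * γ * T)) + K * T := by gcongr; exact le_max_right _ _

/-- **The measure of the set of times of large mass** (Lei–Zhang 2011, p. 10: "if `|W| < 3c₀/4`
then `‖Φ̃‖_{L¹(P(1/2))} < ∫_W 2|B(1/2)| + ∫_{W^c} c₀/2 ≤ … < c₀`, which contradicts (3.1)"):
for a continuous `g` with `g ≤ G_m` on `(a, b]` and `∫_{(a,b]} g ≥ m`, the superlevel set
`W = {s ∈ (a, b] : g(s) ≥ θ}` (`θ ≥ 0`) has measure `≥ (m − θ(b − a))/G_m`. [cite: LeiZhang2011, proof of Lemma 3.2 (arXiv p. 10), the set W] -/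
theorem measureReal_superlevel_ge {g : ℝ → ℝ} (hg : Continuous g) {a b θ Gm m : ℝ} (hab : a ≤ b)
    (hθ : 0 ≤ θ) (hGm : 0 < Gm) (hgG : ∀ s ∈ Ioc a b, g s ≤ Gm)
    (hm : m ≤ ∫ s in Ioc a b, g s) :
    (m - θ * (b - a)) / Gm ≤ volume.real ({s | θ ≤ g s} ∩ Ioc a b) := by
  have hSm : MeasurableSet {s | θ ≤ g s} := (isClosed_le continuous_const hg).measurableSet
  have hIfin : volume (Ioc a b) ≠ ∞ := by rw [Real.volume_Ioc]; exact ENNReal.ofReal_ne_top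
  have hgi : IntegrableOn g (Ioc a b) volume :=
    (hg.continuousOn.integrableOn_compact isCompact_Icc).mono_set Ioc_subset_Icc_self
  set W : Set ℝ := {s | θ ≤ g s} ∩ Ioc a b with hW
  set Wc : Set ℝ := {s | θ ≤ g s}ᶜ ∩ Ioc a b with hWc
  have hWm : MeasurableSet W := hSm.inter measurableSet_Ioc
  have hWcm : MeasurableSet Wc := hSm.compl.inter measurableSet_Ioc
  have hunion : W ∪ Wc = Ioc a b := by
    rw [hW, hWc, ← union_inter_distrib_right, union_compl_self, univ_inter]
  have hdisj : Disjoint W Wc := by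
    rw [hW, hWc]
    exact (disjoint_compl_right.inter_left _).inter_right _
  have hWfin : volume W ≠ ∞ := measure_ne_top_of_subset inter_subset_right hIfin
  have hWcfin : volume Wc ≠ ∞ := measure_ne_top_of_subset inter_subset_right hIfin
  -- `∫ g = ∫_W g + ∫_{Wc} g ≤ Gm |W| + θ |Wc| ≤ Gm |W| + θ (b − a)`
  have hsplit : ∫ s in Ioc a b, g s = (∫ s in W, g s) + ∫ s in Wc, g s := by
    rw [← hunion]
    exact setIntegral_union hdisj hWcm (hgi.mono_set (hunion ▸ subset_union_left))
      (hgi.mono_set (hunion ▸ subset_union_right))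
  have h1 : ∫ s in W, g s ≤ Gm * volume.real W := by
    calc ∫ s in W, g s ≤ ∫ s in W, Gm :=
          setIntegral_mono_on (hgi.mono_set inter_subset_right) (integrableOn_const hWfin) hWm
            fun s hs => hgG s hs.2
      _ = Gm * volume.real W := by rw [setIntegral_const, smul_eq_mul, mul_comm]
  have h2 : ∫ s in Wc, g s ≤ θ * (b - a) := by
    calc ∫ s in Wc, g s ≤ ∫ s in Wc, θ :=
          setIntegral_mono_on (hgi.mono_set inter_subset_right) (integrableOn_const hWcfin) hWcm
            fun s hs => by
              have h : ¬ θ ≤ g s := hs.1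
              exact (not_le.1 h).le
      _ = θ * volume.real Wc := by rw [setIntegral_const, smul_eq_mul, mul_comm]
      _ ≤ θ * (b - a) := by
          refine mul_le_mul_of_nonneg_left ?_ hθ
          calc volume.real Wc ≤ volume.real (Ioc a b) := measureReal_mono inter_subset_right hIfin
            _ = b - a := Real.volume_real_Ioc_of_le hab
  rw [div_le_iff₀ hGm]
  linarith

/-- **From the `L^{1/4}` mass to the `L¹` mass** (weighted AM–GM; replaces Hölder's inequality):
for `F ≥ 0` on a measurable set `B` of finite positive measure, with `F` and `F^{1/4}` integrable
on `B`, `(16/27)(∫_B F^{1/4})⁴/|B|³ ≤ ∫_B F` (pointwise `F^{1/4} ≤ (λ³/4)F + 3/(4λ)`, integrated,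
with `λ = 3|B|/(2∫_B F^{1/4})`). [folklore] -/
theorem setIntegral_ge_of_setIntegral_rpow_quarter {α : Type*} [MeasurableSpace α] {μ : Measure α}
    {F : α → ℝ} {B : Set α} (hB : MeasurableSet B) (hBfin : μ B ≠ ∞) (hBpos : 0 < μ.real B)
    (hF0 : ∀ x ∈ B, 0 ≤ F x) (hFi : IntegrableOn F B μ)
    (hFqi : IntegrableOn (fun x => F x ^ (1 / 4 : ℝ)) B μ) :
    16 / 27 * (∫ x in B, F x ^ (1 / 4 : ℝ) ∂μ) ^ 4 / μ.real B ^ 3 ≤ ∫ x in B, F x ∂μ := by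
  set I : ℝ := ∫ x in B, F x ^ (1 / 4 : ℝ) ∂μ with hI
  set X : ℝ := ∫ x in B, F x ∂μ with hX
  set V : ℝ := μ.real B with hV
  have hX0 : 0 ≤ X := setIntegral_nonneg hB hF0
  have hI0 : 0 ≤ I := setIntegral_nonneg hB fun x hx => Real.rpow_nonneg (hF0 x hx) _
  -- the AM–GM bound `I ≤ (λ³/4) X + (3/(4λ)) V` for every `λ > 0`
  have hamgm : ∀ lam : ℝ, 0 < lam → I ≤ lam ^ 3 / 4 * X + 3 / (4 * lam) * V := by
    intro lam hlam
    have hpt : ∀ x ∈ B, F x ^ (1 / 4 : ℝ) ≤ lam ^ 3 / 4 * F x + 3 / (4 * lam) := by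
      intro x hx
      have h := Real.geom_mean_le_arith_mean2_weighted (w₁ := 1 / 4) (w₂ := 3 / 4)
        (p₁ := F x * lam ^ 3) (p₂ := lam⁻¹) (by norm_num) (by norm_num)
        (mul_nonneg (hF0 x hx) (by positivity)) (by positivity) (by norm_num)
      have e : (F x * lam ^ 3) ^ (1 / 4 : ℝ) * lam⁻¹ ^ (3 / 4 : ℝ) = F x ^ (1 / 4 : ℝ) := by
        rw [Real.mul_rpow (hF0 x hx) (by positivity), ← Real.rpow_natCast lam 3,
          ← Real.rpow_mul hlam.le, Real.inv_rpow hlam.le, ← Real.rpow_neg hlam.le, mul_assoc,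
          ← Real.rpow_add hlam]
        norm_num
      rw [e] at h
      calc F x ^ (1 / 4 : ℝ) ≤ 1 / 4 * (F x * lam ^ 3) + 3 / 4 * lam⁻¹ := h
        _ = lam ^ 3 / 4 * F x + 3 / (4 * lam) := by field_simp
    have hc : IntegrableOn (fun _ : α => 3 / (4 * lam)) B μ := integrableOn_const hBfin
    have hl : IntegrableOn (fun x => lam ^ 3 / 4 * F x) B μ := hFi.const_mul (lam ^ 3 / 4)
    calc I ≤ ∫ x in B, (lam ^ 3 / 4 * F x + 3 / (4 * lam)) ∂μ :=
          setIntegral_mono_on hFqi (hl.add hc) hB hpt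
      _ = lam ^ 3 / 4 * X + 3 / (4 * lam) * V := by
          rw [integral_add hl hc, MeasureTheory.integral_const_mul, setIntegral_const, smul_eq_mul, hX, hV]
          ring
  rcases hI0.eq_or_lt with hI00 | hIpos
  · rw [← hI00]; norm_num; exact hX0
  · -- `λ = 3V/(2I)`: `3/(4λ) V = I/2`, so `I/2 ≤ (λ³/4) X`
    have hlam : 0 < 3 * V / (2 * I) := by positivity
    have h := hamgm (3 * V / (2 * I)) hlam
    have e1 : 3 / (4 * (3 * V / (2 * I))) * V = I / 2 := by
      field_simp
      ring
    rw [e1] at h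
    have h2 : I / 2 ≤ (3 * V / (2 * I)) ^ 3 / 4 * X := by linarith
    have e2 : (3 * V / (2 * I)) ^ 3 / 4 = 27 * V ^ 3 / (32 * I ^ 3) := by field_simp; ring
    rw [e2] at h2
    -- `X ≥ (I/2) · 32 I³/(27 V³) = 16 I⁴/(27 V³)`
    have hV3 : 0 < V ^ 3 := by positivity
    rw [div_mul_eq_mul_div, le_div_iff₀ (by positivity : (0 : ℝ) < 32 * I ^ 3)] at h2
    rw [div_le_iff₀ hV3]
    linarith [h2]

end LeiZhang2011

end Literature.Analysis.FluidPDE
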